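import Summits.RiemannHypothesis.RiemannHypothesis.Theorems.LiPrimeEchoDefs
import Summits.RiemannHypothesis.RiemannHypothesis.Theorems.LiCoefficientsLiBoxSplitPair
import Literature.NumberTheory.LFunctions.MontgomeryZeroSideProofs
import Literature.NumberTheory.LFunctions.RiemannSiegelThetaBounds
import Literature.NumberTheory.LFunctions.RiemannSiegelFacts
import HarnessLib

/-!
# RiemannHypothesis / LiPrimeEcho — Assembly support G: moving the window ends costs `O(log n)` (RH-FREE)

RH-FREE [rh-li-prover].  Route `Theses/LiPrimeEcho.lean` (rung «Li PRIME-ECHO LAW» `LiTheory.LiZeroWindowEcho`, L-P(P1e);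
cell `pub/rh-li`, theory memo `theory/TARGETS.md` §7.10 step G / §12), the registered skeleton statement
`LiWindowAdjust` of the item `Assembly` (stmt-RiemannHypothesis-19249, birth stub `stub_window_adjust`):
for every `c ≥ 1` there are `N`, `C` such that for `n ≥ N`, `√n ≤ T₁ ≤ √n + 1`, `c√n ≤ T₂ ≤ c√n + 1`,

  `|liZeroTraceWindow n √n (c√n) − liZeroTraceWindow n T₁ T₂| ≤ C log n` and
  `|liSmoothTraceWindow n √n (c√n) − liSmoothTraceWindow n T₁ T₂| ≤ C log n`.

Proof.  ZERO TRACE: `liZeroTrace n b − liZeroTrace n a = 2 Σ_{a < Im ρ ≤ b} m Re z_ρⁿ` (conjugation doubles the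
upper half-plane; `liZeroTrace_sub_eq`), and for `Im ρ ≥ √n`, WHATEVER the real part `β ∈ [0, 1]` of the zero,
`|z_ρ|² = 1 + (1 − 2β)/|ρ|² ≤ 1 + 1/γ²`, so `|z_ρⁿ| ≤ e^{n/2γ²} ≤ e^{1/2}` (`norm_pow_one_sub_inv_le`); the number of
zeros in a unit height step is `≤ A log(T + 2)` (`Montgomery.exists_zetaZeroCount_add_one_sub_le`, Riemann–von
Mangoldt).  SMOOTH MEAN: `ϑ' = liGammaDensity` is continuous with `|ϑ'(t)| ≤ ½ log t + 3` for `t ≥ 1`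
(`abs_riemannSiegelThetaDeriv_sub_log_le`), and the two end pieces have length `≤ 1`.
Nothing about the position of the zeros is used; nothing here bears on the truth of RH.
-/

noncomputable section

-- D-0017: `Summit.<S>.<S>.…` is the designed namespace of a single-problem summit.
set_option linter.dupNamespace false

open Complex MeasureTheory intervalIntegral Set
open scoped Real ComplexConjugate Interval

namespace Summit.RiemannHypothesis.RiemannHypothesis.Theorems.LiTheory

open Literature.NumberTheory.LFunctions Literature.NumberTheory.LFunctions.SchoenfeldBound
open BoxSplit

namespace WindowAdjust

/-! ### The zero trace as a one-sided sum -/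

/-- **The zero trace over the upper half-plane**: `liZeroTrace n T = 2 Σ_{0 < Im ρ ≤ T} m(ρ) Re (1 − 1/ρ)ⁿ`
(conjugation is a multiplicity-preserving bijection between the two halves of `liZeroBox T`). -/
theorem liZeroTrace_eq_two_mul_sum (n : ℕ) (T : ℝ) :
    liZeroTrace n T = 2 * ∑ ρ ∈ zerosBetween 0 T, (riemannZetaZeroOrder ρ : ℝ) * ((1 - 1 / ρ) ^ n).re := by
  classical
  unfold liZeroTrace
  rw [finsum_mem_eq_finite_toFinset_sum _ (liZeroBox_finite T), Complex.re_sum]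
  set B := (liZeroBox_finite T).toFinset with hB
  have hmem : ∀ ρ, ρ ∈ B ↔ ρ ∈ liZeroBox T := fun ρ ↦ Set.Finite.mem_toFinset _
  set f : ℂ → ℝ := fun ρ ↦ ((riemannZetaZeroOrder ρ : ℂ) * (1 - 1 / ρ) ^ n).re with hf
  have hfval : ∀ ρ : ℂ, f ρ = (riemannZetaZeroOrder ρ : ℝ) * ((1 - 1 / ρ) ^ n).re := by
    intro ρ
    simp only [hf, Complex.mul_re, Complex.intCast_re, Complex.intCast_im, zero_mul, sub_zero]
  set S := zerosBetween 0 T with hS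
  have hSsub : S ⊆ B := by
    intro ρ hρ
    obtain ⟨hz, h0, h1, h3, h4⟩ := (mem_zerosBetween le_rfl).1 hρ
    rw [hmem]
    exact ⟨hz, h0, h1, by rwa [abs_of_pos h3], by rwa [abs_of_pos h3]⟩
  have hS'sub : S.image conj ⊆ B := by
    intro ρ' hρ'
    obtain ⟨ρ, hρ, rfl⟩ := Finset.mem_image.1 hρ'
    exact (hmem _).2 (conj_mem_of_mem_zerosBetween le_rfl le_rfl hρ).1
  have hcover : B ⊆ S ∪ S.image conj := by
    intro ρ hρ
    obtain ⟨hz, h0, h1, him, hT'⟩ := (hmem ρ).1 hρ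
    have him0 : ρ.im ≠ 0 := abs_pos.1 him
    rw [Finset.mem_union]
    rcases lt_or_gt_of_ne him0 with hneg | hpos
    · right
      rw [Finset.mem_image]
      refine ⟨conj ρ, (mem_zerosBetween le_rfl).2 ⟨by rw [riemannZeta_conj, hz, map_zero], by simpa using h0,
        by simpa using h1, ?_, ?_⟩, by simp⟩
      · rw [Complex.conj_im]; linarith
      · rw [Complex.conj_im]; rw [abs_of_neg hneg] at hT'; exact hT'
    · left
      rw [abs_of_pos hpos] at hT'
      exact (mem_zerosBetween le_rfl).2 ⟨hz, h0, h1, hpos, hT'⟩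
  have hBeq : B = S ∪ S.image conj :=
    Finset.Subset.antisymm hcover (Finset.union_subset hSsub hS'sub)
  have hdisj : Disjoint S (S.image conj) := by
    rw [Finset.disjoint_left]
    intro ρ hρ hρ'
    obtain ⟨ρ₀, hρ₀, he⟩ := Finset.mem_image.1 hρ'
    obtain ⟨-, -, -, h3, -⟩ := (mem_zerosBetween le_rfl).1 hρ
    obtain ⟨-, -, -, h3', -⟩ := (mem_zerosBetween le_rfl).1 hρ₀
    have : ρ.im = -ρ₀.im := by rw [← he, Complex.conj_im]
    linarith
  have hconj_inj : Set.InjOn (conj : ℂ → ℂ) S := fun x _ y _ h ↦ by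
    simpa using congrArg conj h
  have hfconj : ∀ ρ : ℂ, f (conj ρ) = f ρ := by
    intro ρ
    rw [hfval, hfval, riemannZetaZeroOrder_conj_holds ρ]
    congr 1
    have : (1 - 1 / conj ρ) ^ n = conj ((1 - 1 / ρ) ^ n) := by
      simp [map_sub, map_pow]
    rw [this, Complex.conj_re]
  have hSimage : ∑ ρ ∈ S.image conj, f ρ = ∑ ρ ∈ S, f ρ := by
    rw [Finset.sum_image hconj_inj]
    exact Finset.sum_congr rfl fun ρ _ ↦ hfconj ρ
  rw [hBeq, Finset.sum_union hdisj, hSimage, ← two_mul]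
  congr 1
  exact Finset.sum_congr rfl fun ρ _ ↦ hfval ρ

/-- `liZeroTrace n b − liZeroTrace n a = 2 Σ_{a < Im ρ ≤ b} m(ρ) Re (1 − 1/ρ)ⁿ` for `0 ≤ a ≤ b`. -/
theorem liZeroTrace_sub_eq (n : ℕ) {a b : ℝ} (ha : 0 ≤ a) (hab : a ≤ b) :
    liZeroTrace n b - liZeroTrace n a =
      2 * ∑ ρ ∈ zerosBetween a b, (riemannZetaZeroOrder ρ : ℝ) * ((1 - 1 / ρ) ^ n).re := by
  classical
  rw [liZeroTrace_eq_two_mul_sum, liZeroTrace_eq_two_mul_sum, ← mul_sub]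
  congr 1
  have hsub : zerosBetween 0 a ⊆ zerosBetween 0 b := by
    intro ρ hρ
    rw [mem_zerosBetween le_rfl] at hρ ⊢
    exact ⟨hρ.1, hρ.2.1, hρ.2.2.1, hρ.2.2.2.1, hρ.2.2.2.2.trans hab⟩
  have hsd : zerosBetween a b = zerosBetween 0 b \ zerosBetween 0 a := by
    ext ρ
    rw [Finset.mem_sdiff, mem_zerosBetween ha, mem_zerosBetween le_rfl, mem_zerosBetween le_rfl]
    constructor
    · rintro ⟨h0', h1', h2', h3', h4'⟩
      exact ⟨⟨h0', h1', h2', by linarith, h4'⟩, fun h' ↦ by linarith [h'.2.2.2.2]⟩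
    · rintro ⟨⟨h0', h1', h2', h3', h4'⟩, hn'⟩
      refine ⟨h0', h1', h2', ?_, h4'⟩
      by_contra hle
      exact hn' ⟨h0', h1', h2', h3', not_lt.1 hle⟩
  rw [hsd, Finset.sum_sdiff_eq_sub hsub]

/-! ### The Li weight of a zero of large height is bounded, WHATEVER its real part -/

/-- For `Re ρ ≥ 0` and `(Im ρ)² ≥ n ≥ 1`: `‖(1 − 1/ρ)ⁿ‖ ≤ e^{1/2}` (`|1 − 1/ρ|² = 1 + (1 − 2β)/|ρ|² ≤ 1 + 1/γ²`). -/
theorem norm_pow_one_sub_inv_le (n : ℕ) {ρ : ℂ} (h0 : 0 ≤ ρ.re) (hn : 1 ≤ n)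
    (hγ : (n : ℝ) ≤ ρ.im ^ 2) : ‖(1 - 1 / ρ) ^ n‖ ≤ Real.exp (1 / 2) := by
  set β := ρ.re with hβ
  set γ := ρ.im with hγ'
  have hn0 : (0 : ℝ) < n := by exact_mod_cast hn
  have hγ2 : 0 < γ ^ 2 := hn0.trans_le hγ
  have hN : Complex.normSq ρ = β ^ 2 + γ ^ 2 := by rw [Complex.normSq_apply]; ring
  have hNpos : 0 < Complex.normSq ρ := by rw [hN]; positivity
  have hρ0 : ρ ≠ 0 := fun h ↦ by rw [h, map_zero] at hNpos; exact lt_irrefl _ hNpos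
  rw [norm_pow]
  set q := ‖1 - 1 / ρ‖ with hq
  have hq0 : 0 ≤ q := norm_nonneg _
  have hq2 : q ^ 2 = ((β - 1) ^ 2 + γ ^ 2) / (β ^ 2 + γ ^ 2) := by
    have e : 1 - 1 / ρ = (ρ - 1) / ρ := by field_simp
    rw [hq, e, norm_div, div_pow, Complex.sq_norm, Complex.sq_norm, hN, Complex.normSq_apply]
    simp [hβ, hγ']
    ring
  have hq2le : q ^ 2 ≤ 1 + 1 / n := by
    rw [hq2, div_le_iff₀ (by positivity)]
    have h1n : 1 ≤ 1 / (n : ℝ) * (β ^ 2 + γ ^ 2) := by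
      rw [div_mul_eq_mul_div, le_div_iff₀ hn0, one_mul]; nlinarith
    nlinarith
  have hexp : 1 + 1 / (n : ℝ) ≤ Real.exp (1 / n) := by
    have := Real.add_one_le_exp (1 / (n : ℝ)); linarith
  have hpow : (q ^ 2) ^ n ≤ Real.exp (1 / 2) ^ 2 := by
    calc (q ^ 2) ^ n ≤ (1 + 1 / (n : ℝ)) ^ n := pow_le_pow_left₀ (sq_nonneg _) hq2le n
      _ ≤ Real.exp (1 / n) ^ n := pow_le_pow_left₀ (by positivity) hexp n
      _ = Real.exp 1 := by rw [← Real.exp_nat_mul]; congr 1; field_simp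
      _ = Real.exp (1 / 2) ^ 2 := by rw [← Real.exp_nat_mul]; norm_num
  have hsq : (q ^ n) ^ 2 ≤ Real.exp (1 / 2) ^ 2 := by rw [← pow_mul, mul_comm, pow_mul]; exact hpow
  exact (pow_le_pow_iff_left₀ (pow_nonneg hq0 n) (Real.exp_pos _).le two_ne_zero).1 hsq

/-- **Zero-trace step bound (RH-FREE):** for `1 ≤ n ≤ a²` and `a ≤ b`,
`|liZeroTrace n b − liZeroTrace n a| ≤ 2 e^{1/2} (N(b) − N(a))`. -/
theorem abs_liZeroTrace_sub_le (n : ℕ) {a b : ℝ} (hn : 1 ≤ n) (ha : (n : ℝ) ≤ a ^ 2) (ha0 : 0 ≤ a)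
    (hab : a ≤ b) :
    |liZeroTrace n b - liZeroTrace n a| ≤
      2 * Real.exp (1 / 2) * ((zetaZeroCount b : ℝ) - zetaZeroCount a) := by
  rw [liZeroTrace_sub_eq n ha0 hab, zetaZeroCount_sub_eq_sum hab, abs_mul, abs_two, mul_assoc, Finset.mul_sum]
  refine mul_le_mul_of_nonneg_left ((Finset.abs_sum_le_sum_abs _ _).trans (Finset.sum_le_sum fun ρ hρ ↦ ?_))
    (by norm_num)
  obtain ⟨-, h0, -, h3, -⟩ := (mem_zerosBetween ha0).1 hρ
  have hm : (0 : ℝ) ≤ riemannZetaZeroOrder ρ := zeroOrder_nonneg_of_mem_zerosBetween ha0 hρ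
  have hγ : (n : ℝ) ≤ ρ.im ^ 2 := ha.trans (by nlinarith)
  rw [abs_mul, abs_of_nonneg hm, mul_comm (Real.exp _)]
  exact mul_le_mul_of_nonneg_left
    ((Complex.abs_re_le_norm _).trans (norm_pow_one_sub_inv_le n h0 hn hγ)) hm

/-! ### The smooth density -/

/-- PART D's `liGammaDensity` is the tree's `riemannSiegelThetaDeriv` (`Complex.digamma = logDeriv Γ`). -/
theorem liGammaDensity_eq (t : ℝ) : liGammaDensity t = riemannSiegelThetaDeriv t := rfl

/-- `|ϑ'(t)| ≤ ½ log t + 3` for `t ≥ 1` (`|ϑ' − ½ log(t/2π)| ≤ 2/t`, `0 ≤ log 2π ≤ 2`). -/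
theorem abs_liGammaDensity_le {t : ℝ} (ht : 1 ≤ t) : |liGammaDensity t| ≤ Real.log t / 2 + 3 := by
  rw [liGammaDensity_eq]
  have h := abs_riemannSiegelThetaDeriv_sub_log_le ht
  have ht0 : 0 < t := by linarith
  have h2t : 2 / t ≤ 2 := by rw [div_le_iff₀ ht0]; linarith
  have hlog : Real.log (t / (2 * π)) = Real.log t - Real.log (2 * π) := Real.log_div ht0.ne' (by positivity)
  have hl2π0 : 0 ≤ Real.log (2 * π) := Real.log_nonneg (by linarith [Real.pi_gt_three])
  have hl2π : Real.log (2 * π) ≤ 2 := by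
    rw [Real.log_le_iff_le_exp (by positivity)]
    have he := Real.exp_one_gt_d9
    have h4 : Real.exp 2 = Real.exp 1 * Real.exp 1 := by rw [← Real.exp_add]; norm_num
    rw [h4]; nlinarith [Real.pi_lt_d2]
  have hlt : 0 ≤ Real.log t := Real.log_nonneg ht
  rw [hlog] at h
  have h' := abs_le.1 h
  rw [abs_le]; constructor <;> linarith [h'.1, h'.2]

/-- The smooth integrand is continuous on every `[a, b]` with `a > 0`. -/
theorem continuousOn_smooth_integrand (n : ℕ) {a b : ℝ} (ha : 0 < a) (hab : a ≤ b) :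
    ContinuousOn (fun t ↦ Real.cos (n * liZeroAngle t) * liGammaDensity t) (uIcc a b) := by
  rw [uIcc_of_le hab]
  have hθ : ContinuousOn liZeroAngle (Icc a b) := fun t ht ↦
    (hasDerivAt_liZeroAngle (by linarith [ht.1] : t ≠ 0)).continuousAt.continuousWithinAt
  have hcos : ContinuousOn (fun t ↦ Real.cos (n * liZeroAngle t)) (Icc a b) :=
    Real.continuous_cos.comp_continuousOn (continuousOn_const.mul hθ)
  have hϑ : Continuous liGammaDensity := by
    have : liGammaDensity = riemannSiegelThetaDeriv := funext liGammaDensity_eq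
    rw [this]; exact continuous_riemannSiegelThetaDeriv_holds
  exact hcos.mul hϑ.continuousOn

/-- A unit end piece of the smooth mean costs `≤ ½ log(b) + 3`: for `1 ≤ a ≤ a' ≤ a + 1`,
`|∫_a^{a'} cos(nθ) ϑ'| ≤ ½ log(a + 1) + 3`. -/
theorem abs_integral_end_le (n : ℕ) {a a' : ℝ} (ha : 1 ≤ a) (haa' : a ≤ a') (ha' : a' ≤ a + 1) :
    |∫ t in a..a', Real.cos (n * liZeroAngle t) * liGammaDensity t| ≤ Real.log (a + 1) / 2 + 3 := by
  have hpt : ∀ t ∈ Ι a a', ‖Real.cos (n * liZeroAngle t) * liGammaDensity t‖ ≤ Real.log (a + 1) / 2 + 3 := by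
    intro t ht
    rw [uIoc_of_le haa'] at ht
    have ht1 : 1 ≤ t := by linarith [ht.1]
    rw [Real.norm_eq_abs, abs_mul]
    have hc := Real.abs_cos_le_one (n * liZeroAngle t)
    have hg := abs_liGammaDensity_le ht1
    have hlog : Real.log t ≤ Real.log (a + 1) := Real.log_le_log (by linarith) (by linarith [ht.2])
    calc |Real.cos (n * liZeroAngle t)| * |liGammaDensity t| ≤ 1 * (Real.log t / 2 + 3) :=
          mul_le_mul hc hg (abs_nonneg _) zero_le_one
      _ ≤ Real.log (a + 1) / 2 + 3 := by linarith
  have h := intervalIntegral.norm_integral_le_of_norm_le_const hpt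
  rw [Real.norm_eq_abs, abs_of_nonneg (by linarith : (0 : ℝ) ≤ a' - a)] at h
  have hlen : a' - a ≤ 1 := by linarith
  have hK : 0 ≤ Real.log (a + 1) / 2 + 3 := by
    have := Real.log_nonneg (by linarith : (1 : ℝ) ≤ a + 1); linarith
  calc |∫ t in a..a', Real.cos (n * liZeroAngle t) * liGammaDensity t|
      ≤ (Real.log (a + 1) / 2 + 3) * (a' - a) := h
    _ ≤ (Real.log (a + 1) / 2 + 3) * 1 := mul_le_mul_of_nonneg_left hlen hK
    _ = Real.log (a + 1) / 2 + 3 := mul_one _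

end WindowAdjust

open WindowAdjust in
/-- **Assembly support G of route `LiPrimeEcho` (`LiWindowAdjust`, birth stub `stub_window_adjust`; RH-FREE):**
for every `c ≥ 1` there are `N`, `C` such that for `n ≥ N` and `√n ≤ T₁ ≤ √n + 1`, `c√n ≤ T₂ ≤ c√n + 1`, moving the
window `(√n, c√n]` to `(T₁, T₂]` changes the zero trace and the smooth mean by at most `C log n` each.  Verbatim the
registered skeleton statement. -/
theorem liWindowAdjust :
    ∀ c : ℝ, 1 ≤ c → ∃ N : ℕ, ∃ C : ℝ, ∀ n : ℕ, N ≤ n → ∀ T₁ T₂ : ℝ, Real.sqrt n ≤ T₁ → T₁ ≤ Real.sqrt n + 1 →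
      c * Real.sqrt n ≤ T₂ → T₂ ≤ c * Real.sqrt n + 1 →
      |liZeroTraceWindow n (Real.sqrt n) (c * Real.sqrt n) - liZeroTraceWindow n T₁ T₂| ≤ C * Real.log n ∧
      |liSmoothTraceWindow n (Real.sqrt n) (c * Real.sqrt n) - liSmoothTraceWindow n T₁ T₂| ≤ C * Real.log n := by
  intro c hc
  obtain ⟨A, hA0, hA⟩ := Montgomery.exists_zetaZeroCount_add_one_sub_le
  refine ⟨⌈(c + 2) ^ 2⌉₊, 4 * Real.exp (1 / 2) * A + 7, fun n hn T₁ T₂ hT₁l hT₁u hT₂l hT₂u ↦ ?_⟩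
  -- sizes
  have hc2 : (c + 2) ^ 2 ≤ (n : ℝ) := (Nat.le_ceil _).trans (by exact_mod_cast hn)
  set s := Real.sqrt n with hs
  have hn0 : (0 : ℝ) ≤ n := by positivity
  have hss : s ^ 2 = n := by rw [hs, Real.sq_sqrt hn0]
  have hs3 : c + 2 ≤ s := by
    rw [hs, ← Real.sqrt_sq (by linarith : 0 ≤ c + 2)]; exact Real.sqrt_le_sqrt hc2
  have hs1 : 1 ≤ s := by linarith
  have hs0 : 0 < s := by linarith
  have hn9 : (9 : ℝ) ≤ n := by nlinarith
  have hn1 : 1 ≤ n := by exact_mod_cast (show (1 : ℝ) ≤ n by linarith)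
  have hcs : s ≤ c * s := le_mul_of_one_le_left hs0.le hc
  -- `log(c s + 2) ≤ log n`, `log(s + 2) ≤ log n`, `1 ≤ log n`
  have htop : c * s + 2 ≤ n := by
    have : (c + 2) * s ≤ s * s := mul_le_mul_of_nonneg_right hs3 hs0.le
    nlinarith
  have hlogn1 : 1 ≤ Real.log n := by
    rw [Real.le_log_iff_exp_le (by linarith)]
    have := Real.exp_one_lt_d9; linarith
  have hlog_cs : Real.log (c * s + 2) ≤ Real.log n := Real.log_le_log (by positivity) htop
  have hlog_s : Real.log (s + 2) ≤ Real.log n := Real.log_le_log (by positivity) (by nlinarith)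
  have hlogn0 : 0 ≤ Real.log n := by linarith
  constructor
  · -- ZERO TRACE
    have hZ : liZeroTraceWindow n s (c * s) - liZeroTraceWindow n T₁ T₂ =
        (liZeroTrace n T₁ - liZeroTrace n s) - (liZeroTrace n T₂ - liZeroTrace n (c * s)) := by
      unfold liZeroTraceWindow; ring
    rw [hZ]
    have hns : (n : ℝ) ≤ s ^ 2 := hss.ge
    have hncs : (n : ℝ) ≤ (c * s) ^ 2 := by nlinarith
    have h1 := abs_liZeroTrace_sub_le n hn1 hns hs0.le hT₁l
    have h2 := abs_liZeroTrace_sub_le n hn1 hncs (by positivity) hT₂l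
    -- counts in the unit steps
    have hN1 : (zetaZeroCount T₁ : ℝ) - zetaZeroCount s ≤ A * Real.log n := by
      have hm : (zetaZeroCount T₁ : ℝ) ≤ zetaZeroCount (s + 1) := by exact_mod_cast zetaZeroCount_mono hT₁u
      have := hA s hs0.le
      nlinarith [Real.log_le_log (by positivity : (0 : ℝ) < s + 2) (le_refl _)]
    have hN2 : (zetaZeroCount T₂ : ℝ) - zetaZeroCount (c * s) ≤ A * Real.log n := by
      have hm : (zetaZeroCount T₂ : ℝ) ≤ zetaZeroCount (c * s + 1) := by exact_mod_cast zetaZeroCount_mono hT₂u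
      have := hA (c * s) (by positivity)
      nlinarith
    have he := Real.exp_pos (1 / 2 : ℝ)
    calc |liZeroTrace n T₁ - liZeroTrace n s - (liZeroTrace n T₂ - liZeroTrace n (c * s))|
        ≤ |liZeroTrace n T₁ - liZeroTrace n s| + |liZeroTrace n T₂ - liZeroTrace n (c * s)| := abs_sub _ _
      _ ≤ 2 * Real.exp (1 / 2) * (A * Real.log n) + 2 * Real.exp (1 / 2) * (A * Real.log n) :=
          add_le_add (h1.trans (mul_le_mul_of_nonneg_left hN1 (by positivity)))
            (h2.trans (mul_le_mul_of_nonneg_left hN2 (by positivity)))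
      _ = (4 * Real.exp (1 / 2) * A) * Real.log n := by ring
      _ ≤ (4 * Real.exp (1 / 2) * A + 7) * Real.log n := by nlinarith
  · -- SMOOTH MEAN
    set g : ℝ → ℝ := fun t ↦ Real.cos (n * liZeroAngle t) * liGammaDensity t with hg
    have hint : ∀ a b : ℝ, 0 < a → a ≤ b → IntervalIntegrable g volume a b := fun a b ha hab ↦
      (continuousOn_smooth_integrand n ha hab).intervalIntegrable
    have i1 : IntervalIntegrable g volume s T₁ := hint s T₁ hs0 hT₁l
    have i2 : IntervalIntegrable g volume T₁ (c * s) := by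
      rcases le_total T₁ (c * s) with h | h
      · exact hint T₁ (c * s) (by linarith) h
      · exact (hint (c * s) T₁ (by positivity) h).symm
    have i3 : IntervalIntegrable g volume (c * s) T₂ := hint (c * s) T₂ (by positivity) hT₂l
    have hsplit : (∫ t in s..(c * s), g t) - ∫ t in T₁..T₂, g t = (∫ t in s..T₁, g t) - ∫ t in (c * s)..T₂, g t := by
      rw [← intervalIntegral.integral_add_adjacent_intervals i1 i2,
        ← intervalIntegral.integral_add_adjacent_intervals i2 i3]
      ring
    have hS : liSmoothTraceWindow n s (c * s) - liSmoothTraceWindow n T₁ T₂ =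
        2 / Real.pi * ((∫ t in s..T₁, g t) - ∫ t in (c * s)..T₂, g t) := by
      unfold liSmoothTraceWindow; rw [← hsplit, mul_sub]
    rw [hS, abs_mul, abs_of_pos (by positivity : (0 : ℝ) < 2 / Real.pi)]
    have e1 := abs_integral_end_le n hs1 hT₁l hT₁u
    have e2 := abs_integral_end_le n (le_trans hs1 hcs) hT₂l hT₂u
    have hl1 : Real.log (s + 1) ≤ Real.log n := (Real.log_le_log (by positivity) (by linarith)).trans hlog_s
    have hl2 : Real.log (c * s + 1) ≤ Real.log n :=
      (Real.log_le_log (by positivity) (by linarith)).trans hlog_cs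
    have hπ : 2 / Real.pi ≤ 1 := by rw [div_le_one Real.pi_pos]; linarith [Real.pi_gt_three]
    have hsum : |(∫ t in s..T₁, g t) - ∫ t in (c * s)..T₂, g t| ≤ 7 * Real.log n := by
      refine (abs_sub _ _).trans ?_
      have := add_le_add e1 e2
      linarith
    have hA7 : 7 * Real.log n ≤ (4 * Real.exp (1 / 2) * A + 7) * Real.log n := by
      have : 0 ≤ 4 * Real.exp (1 / 2) * A * Real.log n := by positivity
      linarith
    calc 2 / Real.pi * |(∫ t in s..T₁, g t) - ∫ t in (c * s)..T₂, g t| ≤ 1 * (7 * Real.log n) :=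
          mul_le_mul hπ hsum (abs_nonneg _) zero_le_one
      _ ≤ (4 * Real.exp (1 / 2) * A + 7) * Real.log n := by linarith

end Summit.RiemannHypothesis.RiemannHypothesis.Theorems.LiTheory

end
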